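import Summits.BirchSwinnertonDyer.BirchSwinnertonDyer.Theorems.PrintCf2RubinValueTwoKatzMeasureJZeroSeamClassSumAtLevel
import HarnessLib

/-!
# The SEAM of the `j = 0` lane, PART 1a (file 3/3): hsum's ∃-body AT ONE CHAIN LEVEL, for the packager's scalars

Cell `bsd-print-cf2`, width seat `bsd-line-cf2-p1-w8` g13; `--supports` the crux stmt-BirchSwinnertonDyer-20368 (helper, Theses-free).  THEOREMS ONLY; no `def`,
no named fact, no `sorry`; CONDITIONAL on the prints `DeShalit1987.prop24_ii_galoisAction`, `prop24_iii_unit`, `prop25_i_normRelation`.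
`hsumBody_at_level_of_perUnitValues`: the RAW identity of `classSum_at_level_of_perUnitValues` (file 2/3) turned into the seam hypothesis shape of
`KatzMeasureJZeroTop.integral_avatar_eq_interpolationValue_of_twistedClassSums` (hsum's `∃ T L` body, `w₁ := w₀`) with `μ.integral ê ↦ I′`, for ANY scalars
`(I′, Ω₂, D)` with `12·I′ = D·Θ(ε_ϑ)·∫ ê dμ` and `Ω₂^m = D·(Θ(ε_ϑ)·A₁)^m·ι⁻¹(σ(β₁)^{−m}·χ̃λ̃^m((β₁)))` — the packager's (-w3 g31, `P1`/`chainSeam_of_root_of_perLevel`)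
twelfth root TW(b), Q-θ translate `D = ê(τ)` (`(twisting τ 0 μ).integral ê`), Tate unit and `U_τ` inside `Ω₂`.  Nothing here closes a crux; no summit statement is
proved; BSD is not proved by any of this.
References: [deShalit1987] II.4.14 (36)–(40) (p. 71–73), II.4.12 (31) (p. 66–69).
-/


-- the summit namespace `Summit.BirchSwinnertonDyer.BirchSwinnertonDyer` repeats the problem name by design (D-0017)
set_option linter.dupNamespace false
set_option autoImplicit false

noncomputable section

open scoped Classical nonZeroDivisors NumberField
open NumberField Field IsDedekindDomain IsDedekindDomain.HeightOneSpectrum ValuativeRel IsLocalRing Literature.NumberTheory.NumberFields Literature.NumberTheory.PAdicHodge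
open Literature.NumberTheory.GaloisRepresentations Literature.NumberTheory.GaloisRepresentations.IsNonarchimedeanLocalField Literature.NumberTheory.GaloisRepresentations.LubinTate
  Literature.NumberTheory.GaloisRepresentations.ArtinLocalGlobal Literature.NumberTheory.GaloisRepresentations.HeckeCharacter
open Literature.NumberTheory.EllipticCurves Literature.NumberTheory.EllipticCurves.GroupDistribution Literature.NumberTheory.EllipticCurves.DeShalit1987
open Literature.NumberTheory.ComplexMultiplication.EllipticUnits Literature.NumberTheory.LFunctions
open Literature.NumberTheory.LFunctions.AbelianDensity (artinSymbol)
open Summit.BirchSwinnertonDyer.BirchSwinnertonDyer.Theorems.PrintCf2.EllipticUnitsLocal Summit.BirchSwinnertonDyer.BirchSwinnertonDyer.Theorems.PrintCf2.EllipticUnitsGlobal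
  Summit.BirchSwinnertonDyer.BirchSwinnertonDyer.Theorems.PrintCf2.EllipticUnitsGlobalCompat Summit.BirchSwinnertonDyer.BirchSwinnertonDyer.Theorems.PrintCf2.EllipticUnitsTwoVariable

namespace Summit.BirchSwinnertonDyer.BirchSwinnertonDyer.Theorems.PrintCf2.KatzMeasureJZeroSeam

attribute [local instance] GlobalNormCoherentUnits.instCommMonoid GlobalNormCoherentUnits.galAction RelNormCoherentUnits.instCommMonoid
attribute [local instance] ltNormUniformSpace ltNormIsUniformAddGroup rk1 nF nE fintypeResidueField

set_option maxHeartbeats 1600000 in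
/-- ★★ **hsum's twisted class-sum identity AT THE CHAIN LEVEL `k`**, in the shape of the seam hypothesis of
`KatzMeasureJZeroTop.integral_avatar_eq_interpolationValue_of_twistedClassSums` with `μ.integral ê ↦ I′` (`w₁ := w₀`): for scalars with
`12·I′ = D·Θ(ε_ϑ)·∫ ê dμ` and `Ω₂^m = D·(Θ(ε_ϑ)·A₁)^m·ι⁻¹(σ(β₁)^{−m}·χ̃λ̃^m((β₁)))`.  GIVEN II.2.4 (ii)/(iii), II.2.5 (i).
[cite: deShalit1987, II.4.14 (36)–(40) (p. 71–73), II.4.12 (31) (p. 66–69)] -/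
theorem hsumBody_at_level_of_perUnitValues
    -- the prints
    (h24ii : DeShalit1987.prop24_ii_galoisAction) (h24iii : DeShalit1987.prop24_iii_unit) (h25 : DeShalit1987.prop25_i_normRelation)
    -- the frame
    {K : Type} [Field K] [NumberField K] [IsTotallyComplex K] (hK : IsImaginaryQuadratic K) (ι : PadicAlgCl 2 ≃+* ℂ) (w₀ : InfinitePlace K) {v vbar : HeightOneSpectrum (𝓞 K)} (hv2 : ((2 : ℕ) : 𝓞 K) ∈ v.asIdeal) (hvbar2 : ((2 : ℕ) : 𝓞 K) ∈ vbar.asIdeal) (hne : vbar ≠ v)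
    (hι : ∀ (w : InfinitePlace K) (k : 𝓞 K), k ∈ v.asIdeal ↔ ‖ι.symm (w.embedding (k : K))‖ < 1) {α₀ : 𝓞 K} (hv0 : v.asIdeal = Ideal.span {α₀})
    -- the local datum
    (hq : residueFieldCard (v.adicCompletion K) = 2) (h2 : (valuation (v.adicCompletion K)).IsUniformizer ((((2 : ℕ) : 𝒪[v.adicCompletion K]) : v.adicCompletion K))) (u : 𝒪[v.adicCompletion K]ˣ)
    (hu : ((((u : 𝒪[v.adicCompletion K]) * ((2 : ℕ) : 𝒪[v.adicCompletion K]) : 𝒪[v.adicCompletion K]) : v.adicCompletion K)) = ((α₀ : K) : v.adicCompletion K)) {σ₀ : absoluteGaloisGroup (v.adicCompletion K)} (hσ₀ : IsAbsArithFrob σ₀) {ε : (maxUnramifiedCompletion (v.adicCompletion K))ˣ}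
    (hε : maxUnramifiedCompletion.galAut (v.adicCompletion K) σ₀ (ε : maxUnramifiedCompletion (v.adicCompletion K)) = algebraMap 𝒪[v.adicCompletion K] (maxUnramifiedCompletion (v.adicCompletion K)) (u : 𝒪[v.adicCompletion K]) * (ε : maxUnramifiedCompletion (v.adicCompletion K)))
    (θ : CompletedAlgClosure (v.adicCompletion K) →+* ℂ_[2]) (hθc : Continuous θ) (hθ1 : ∀ z : CBall (v.adicCompletion K), ‖θ (z : CompletedAlgClosure (v.adicCompletion K))‖ ≤ 1) (hθζ : ∀ ζ' : ℂ_[2], (∃ n : ℕ, ζ' ^ 2 ^ n = 1) →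
      ∃ ζ : CompletedAlgClosure (v.adicCompletion K), (∃ n : ℕ, ζ ^ 2 ^ n = 1) ∧ θ ζ = ζ') (e₂ : v.adicCompletionIntegers K ≃+* ℤ_[2]) (hΘe : ∀ a : 𝒪[v.adicCompletion K], (θ.comp ((CBall (v.adicCompletion K)).subtype.comp
        (algebraMap (UnrCoeff (v.adicCompletion K)) (CBall (v.adicCompletion K))))) (intToUnrCoeff (v.adicCompletion K) a) = padicIntCast ℂ_[2] (((e₂ : v.adicCompletionIntegers K →+* ℤ_[2]).comp (integerEquivAdicCompletionIntegers v).toRingHom) a))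
    -- the tame set and the chain
    {S : Finset (HeightOneSpectrum (𝓞 K))} (hvS : v ∉ S) (hvbarS : vbar ∉ S) (𝔣 : ℕ → Ideal (𝓞 K)) (𝔩 : ℕ → HeightOneSpectrum (𝓞 K)) (h𝔣succ : ∀ k, 𝔣 (k + 1) = 𝔣 k * (𝔩 k).asIdeal) (hdiv : ∀ k, (𝔩 k).asIdeal ∣ 𝔣 k) (hcof : ∀ m : ℕ, ∃ n, 𝔣 n ≤ ((∏ w ∈ S, w.asIdeal) * vbar.asIdeal) ^ m)
    -- D2's frame VERBATIM
    (h𝔣0 : ∀ m : ℕ, 𝔣 m ≠ ⊥) (h𝔣1 : ∀ m : ℕ, 𝔣 m ≠ ⊤) (hvm : ∀ m : ℕ, ¬ 𝔣 m ≤ v.asIdeal) (hwm : ∀ (m : ℕ) (u : (𝓞 K)ˣ), (u : 𝓞 K) - 1 ∈ 𝔣 m → u = 1) (hle : ∀ m : ℕ, 𝔣 (m + 1) ≤ 𝔣 m) (α : ℕ → 𝓞 K) (hα0 : ∀ m, α m ≠ 0) (hα𝔣 : ∀ m, α m - 1 ∈ 𝔣 m)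
    (hαw : ∀ (m : ℕ) (w : HeightOneSpectrum (𝓞 K)), w ≠ v → α m ∉ w.asIdeal) (f : ℕ → ℕ) (hαπ : ∀ m, ((α m : K) : v.adicCompletion K) = ((((u : 𝒪[v.adicCompletion K]) * ((2 : ℕ) : 𝒪[v.adicCompletion K]) : 𝒪[v.adicCompletion K]) : v.adicCompletion K)) ^ f m)
    (E : ℕ → IntermediateField (v.adicCompletion K) (AlgebraicClosure (v.adicCompletion K))) [hfd : ∀ m, FiniteDimensional (v.adicCompletion K) (E m)] [hgal : ∀ m, IsGalois (v.adicCompletion K) (E m)] (hE : ∀ m, E m ≤ maxUnramified (v.adicCompletion K))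
    (hdegE : ∀ (m : ℕ) (w : WeilGroup (v.adicCompletion K)), WeilGroup.toAbsGalois (v.adicCompletion K) w ∈ (E m).fixingSubgroup → (f m : ℤ) ∣ WeilGroup.deg w) (hEE : ∀ m, E m ≤ E (m + 1)) (j : ∀ m : ℕ, unitBall (E m) →+* UnrCoeff (v.adicCompletion K))
    (hj : ∀ m, (j m).comp (algebraMap (LTCoeff (v.adicCompletion K)) (unitBall (E m))) = (intToUnrCoeff (v.adicCompletion K)).comp (LTCoeff.of (v.adicCompletion K)).symm.toRingHom)
    (hjC : ∀ m, (algebraMap (UnrCoeff (v.adicCompletion K)) (CBall (v.adicCompletion K))).comp (j m) = unitBallToCBall (E m)) (hjj : ∀ (m : ℕ) (y : unitBall (E m)), j (m + 1) (inclUnitBall (F := v.adicCompletion K) (hEE m) y) = j m y)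
    (ψ : ∀ m n : ℕ, ↥(absRestrictNormalHom (rayClassField K (𝔣 m))).ker ⧸ (rayAdicTower (𝔪 := 𝔣 m) (h𝔣0 m) v).U n → ZMod (2 ^ (n + 1))) (hψ : ∀ (m n : ℕ) (g : ↥(absRestrictNormalHom (rayClassField K (𝔣 m))).ker), g ∈ (rayAdicTower (𝔪 := 𝔣 m) (h𝔣0 m) v).U 0 →
      ψ m n ((rayAdicTower (𝔪 := 𝔣 m) (h𝔣0 m) v).proj n g) = PadicInt.toZModPow (n + 1) ((((Units.map (e₂ : v.adicCompletionIntegers K →+* ℤ_[2]).toMonoidHom).comp (rayAdicCharacter (h𝔣0 m) (hvm m) (hwm m)))⁻¹ g : ℤ_[2]ˣ) : ℤ_[2]))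
    (g : {c : Ideal (𝓞 K) // c ≠ ⊥ ∧ IsCoprime c (𝔣 0 * v.asIdeal)} → absoluteGaloisGroup K) (hg : ∀ (c : {c : Ideal (𝓞 K) // c ≠ ⊥ ∧ IsCoprime c (𝔣 0 * v.asIdeal)}) (m k : ℕ), absRestrictNormalHom (rayClassField K (𝔣 m * v.asIdeal ^ (k + 1))) (g c) =
        artinSymbol (galFrob K (rayClassField K (𝔣 m * v.asIdeal ^ (k + 1)))) c.1) (x : ∀ (_ : {c : Ideal (𝓞 K) // c ≠ ⊥ ∧ IsCoprime c (𝔣 0 * v.asIdeal)}) (m k : ℕ), rayClassField K (𝔣 m * v.asIdeal ^ (k + 1))) (hx : ∀ (c : {c : Ideal (𝓞 K) // c ≠ ⊥ ∧ IsCoprime c (𝔣 0 * v.asIdeal)}) (m k : ℕ),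
      IsThetaValueOne w₀.embedding (𝔣 m * v.asIdeal ^ (k + 1)) c.1 (algClosureEmb w₀.embedding ((x c m k : rayClassField K (𝔣 m * v.asIdeal ^ (k + 1))) : AlgebraicClosure K))) [hN : ∀ m n, ((rayAdicTower (𝔪 := 𝔣 m) (h𝔣0 m) v).U n).Normal]
    [hNabs : ∀ m n, ((absRayAdicTower (𝔪' := 𝔣 m) (h𝔣0 m) v).U n).Normal] (μ : GroupDistribution (SubgroupTower.diagonal (fun m ↦ absRayAdicTower (𝔪' := 𝔣 m) (h𝔣0 m) v) (fun m n ↦ absRayAdicTower_U_anti (h𝔣0 m) (h𝔣0 (m + 1)) v (hle m) n)) ℂ_[2])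
    (hμ : ∀ (c : {c : Ideal (𝓞 K) // c ≠ ⊥ ∧ IsCoprime c (𝔣 0 * v.asIdeal)}) (n : ℕ) (b : absoluteGaloisGroup K ⧸ (absRayAdicTower (𝔪' := 𝔣 n) (h𝔣0 n) v).U n), (twisting (g c) (Ideal.absNorm c.1 : ℂ_[2]) μ).μ n b = (GroupDistribution.induceFrom (Γ := absoluteGaloisGroup K)
        (fun k ↦ rayAdicTower_U_eq_subgroupOf (𝔪 := 𝔣 n) (h𝔣0 n) v k) (fun b : GlobalNormCoherentUnits (h𝔣0 n) v ↦ localMeasureFamily (h𝔣0 n) (hvm n) (hwm n) hq h2 u (E n) (hE n) hσ₀ hε θ hθ1 (j n) (hjC n) e₂ (ψ n) (hψ n)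
            (RelNormCoherentUnits.ofGlobalUnits (h𝔣0 n) (hvm n) (hwm n) (isUniformizer_unit_mul h2 u) (hα0 n) (hα𝔣 n) (hαw n) (hαπ n) (E n) (hE n) (hdegE n) b)) zero_le_one (fun _ ↦ le_rfl)
        (ellipticUnitsGlobal h24iii h25 hK w₀.embedding (h𝔣0 n) (h𝔣1 n) (hvm n) (hwm n) c.2.1 (isCoprime_chain 𝔣 𝔩 h𝔣succ hdiv c.2.2 n) (x c n) (hx c n))).μ n b)
    -- the level and ONE instance of hsum's data
    (k M : ℕ) (hkM : 𝔣 k = modulusIdeal (insert vbar S) (fun _ ↦ M)) (lam : HeckeCharacter K) (hl : lam.HasInfinityType (fun _ ↦ 1) (fun _ ↦ 0)) (hlmod : lam.IsModulus (insert vbar S) (fun _ ↦ M)) (h𝔪1 : modulusIdeal (insert vbar S) (fun _ ↦ M) ≠ ⊤)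
    (hw : ∀ uu : (𝓞 K)ˣ, (uu : 𝓞 K) - 1 ∈ modulusIdeal (insert vbar S) (fun _ ↦ M) → uu = 1) (χ : HeightOneSpectrum (𝓞 K) → ℂ) (hχ : IsRayClassCharacter (modulusIdeal (insert vbar S) (fun _ ↦ M)) χ) (𝔠 : Ideal (𝓞 K)) (h𝔠0 : 𝔠 ≠ ⊥) (h𝔠cop : IsCoprime 𝔠 (modulusIdeal (insert vbar S) (fun _ ↦ M)))
    (h𝔠v : IsCoprime 𝔠 v.asIdeal) (εH : HeckeCharacter K) (eH : FramedGaloisRep K (PadicAlgCl 2) 1) (m : ℕ) (he : IsPAdicAvatarOutside S ι εH eH) (hm : 3 ≤ m) (hεt : εH.HasInfinityType (fun _ ↦ -(m : ℤ)) (fun _ ↦ 0)) (hεunr : ∀ w : HeightOneSpectrum (𝓞 K), w ∉ S → w ≠ vbar → εH.IsUnramifiedAt w)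
    (hεu : ∀ w : HeightOneSpectrum (𝓞 K), ¬ modulusIdeal (insert vbar S) (fun _ ↦ M) ≤ w.asIdeal → εH.valueAtUniformizer w = (χ w)⁻¹ * (lam.valueAtUniformizer w ^ m)⁻¹) (hL : LFunction.HasEntireContinuation (heckeLFunction εH))
    -- the value constant, the periods (lattice scale `Ω`, evaluation point `Ω₁ = σ(β₁)Ω`, Frobenius point `Ω₁′ = σ(α₀)Ω₁`), the lattices
    (A₁ : ℂ_[2]) (Ω : ℂ) (hΩ : Ω ≠ 0) {β₁ : 𝓞 K} (hβ₁ : IsCoprime (Ideal.span {β₁}) (modulusIdeal (insert vbar S) (fun _ ↦ M) * v.asIdeal)) (Ω₁ : ℂ) (hΩ₁ : Ω₁ = w₀.embedding ((β₁ : 𝓞 K) : K) * Ω) (Ω₁' : ℂ) (hΩ₁' : Ω₁' = w₀.embedding ((α₀ : 𝓞 K) : K) * Ω₁)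
    (LM : PeriodPair) (hLM : ∀ z : ℂ, z ∈ LM.lattice ↔ ∃ y ∈ ((modulusIdeal (insert vbar S) (fun _ ↦ M) : Ideal (𝓞 K)) : FractionalIdeal (𝓞 K)⁰ K), z = Ω * w₀.embedding y) (Lat : Ideal (𝓞 K) → PeriodPair) (hLat : ∀ 𝔟 : Ideal (𝓞 K), 𝔟 ≠ ⊥ → ∀ z : ℂ, z ∈ (Lat 𝔟).lattice ↔
      ∃ y ∈ ((modulusIdeal (insert vbar S) (fun _ ↦ M) : FractionalIdeal (𝓞 K)⁰ K) / (𝔟 : FractionalIdeal (𝓞 K)⁰ K)), z = Ω * w₀.embedding y)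
    -- ★ the per-unit VALUE identities ((γ)-FAM's output shape, ONE value constant `A₁`, every family index, every moment)
    (hvals : ∀ (i : {c : Ideal (𝓞 K) // c ≠ ⊥ ∧ IsCoprime c (𝔣 0 * v.asIdeal)}) (k' : ℕ), (θ.comp ((CBall (v.adicCompletion K)).subtype.comp (algebraMap (UnrCoeff (v.adicCompletion K)) (CBall (v.adicCompletion K))))) (j k (PowerSeries.constantCoeff ((fun g' : PowerSeries (unitBall (E k)) =>
          (invDiff (isLTRing_LTCoeff (isUniformizer_unit_mul h2 u)) (isLTSeries_LTCoeff ((u : 𝒪[v.adicCompletion K]) * ((2 : ℕ) : 𝒪[v.adicCompletion K])))).map (algebraMap (LTCoeff (v.adicCompletion K)) (unitBall (E k))) * PowerSeries.derivative (unitBall (E k)) g')^[k']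
          (relLogDerivSeries (isUniformizer_unit_mul h2 u) (E k) hq (hE k) hσ₀ (RelNormCoherentUnits.ofGlobalUnits (h𝔣0 k) (hvm k) (hwm k) (isUniformizer_unit_mul h2 u) (hα0 k) (hα𝔣 k) (hαw k) (hαπ k) (E k) (hE k) (hdegE k)
              (ellipticUnitsGlobal h24iii h25 hK w₀.embedding (h𝔣0 k) (h𝔣1 k) (hvm k) (hwm k) i.2.1 (isCoprime_chain 𝔣 𝔩 h𝔣succ hdiv i.2.2 k) (x i k) (hx i k))))))) = A₁ ^ (k' + 1) * ((ι.symm (-12 * (((Ideal.absNorm i.1 : ℕ) : ℂ) * LM.eisensteinE (k' + 1) Ω₁ - (Lat i.1).eisensteinE (k' + 1) Ω₁)) :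
            PadicAlgCl 2) : ℂ_[2]) ∧ (θ.comp ((CBall (v.adicCompletion K)).subtype.comp (algebraMap (UnrCoeff (v.adicCompletion K)) (CBall (v.adicCompletion K))))) (j k ((frobUnitBall (E k) σ₀ : unitBall (E k) →+* unitBall (E k)) (PowerSeries.constantCoeff ((fun g' : PowerSeries (unitBall (E k)) =>
          (invDiff (isLTRing_LTCoeff (isUniformizer_unit_mul h2 u)) (isLTSeries_LTCoeff ((u : 𝒪[v.adicCompletion K]) * ((2 : ℕ) : 𝒪[v.adicCompletion K])))).map (algebraMap (LTCoeff (v.adicCompletion K)) (unitBall (E k))) * PowerSeries.derivative (unitBall (E k)) g')^[k']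
          (relLogDerivSeries (isUniformizer_unit_mul h2 u) (E k) hq (hE k) hσ₀ (RelNormCoherentUnits.ofGlobalUnits (h𝔣0 k) (hvm k) (hwm k) (isUniformizer_unit_mul h2 u) (hα0 k) (hα𝔣 k) (hαw k) (hαπ k) (E k) (hE k) (hdegE k)
              (ellipticUnitsGlobal h24iii h25 hK w₀.embedding (h𝔣0 k) (h𝔣1 k) (hvm k) (hwm k) i.2.1 (isCoprime_chain 𝔣 𝔩 h𝔣succ hdiv i.2.2 k) (x i k) (hx i k)))))))) = A₁ ^ (k' + 1) *
          ((ι.symm (-12 * (((Ideal.absNorm i.1 : ℕ) : ℂ) * LM.eisensteinE (k' + 1) Ω₁' - (Lat i.1).eisensteinE (k' + 1) Ω₁')) : PadicAlgCl 2) : ℂ_[2]))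
    -- the packager's scalars
    (I' : ℂ_[2]) (Ωp : (unrIntegers 2)ˣ) (D : ℂ_[2]) (hI : (12 : ℂ_[2]) * I' = D * ((θ.comp ((CBall (v.adicCompletion K)).subtype.comp (algebraMap (UnrCoeff (v.adicCompletion K)) (CBall (v.adicCompletion K)))))
          (PowerSeries.coeff 1 (compSeriesC h2 hσ₀ u hε)) * μ.integral (fun σ ↦ avatarValueAt eH σ))) (hΩp : ((Ωp : unrIntegers 2) : ℂ_[2]) ^ m = D * (((θ.comp ((CBall (v.adicCompletion K)).subtype.comp (algebraMap (UnrCoeff (v.adicCompletion K)) (CBall (v.adicCompletion K)))))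
                (PowerSeries.coeff 1 (compSeriesC h2 hσ₀ u hε)) * A₁) ^ m * ((ι.symm (((w₀.embedding ((β₁ : 𝓞 K) : K)) ^ m)⁻¹ * (idealPow K χ (Ideal.span {β₁}) * idealPow K (fun w ↦ lam.valueAtUniformizer w) (Ideal.span {β₁}) ^ m)) : PadicAlgCl 2) : ℂ_[2]))) :
    ∃ (T : Finset (Ideal (𝓞 K))) (L : Ideal (𝓞 K) → PeriodPair), IsRayClassReps (modulusIdeal (insert vbar S) (fun _ ↦ M)) T ∧ (∀ 𝔟 ∈ T, ∀ z : ℂ, z ∈ (L 𝔟).lattice ↔ ∃ y ∈ ((modulusIdeal (insert vbar S) (fun _ ↦ M) : FractionalIdeal (𝓞 K)⁰ K) /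
          (𝔟 : FractionalIdeal (𝓞 K)⁰ K)), z = Ω * w₀.embedding y) ∧ (∀ 𝔟 ∈ T, ∀ z : ℂ, z ∈ (L (𝔠 * 𝔟)).lattice ↔ ∃ y ∈ ((modulusIdeal (insert vbar S) (fun _ ↦ M) : FractionalIdeal (𝓞 K)⁰ K) / ((𝔠 * 𝔟 : Ideal (𝓞 K)) : FractionalIdeal (𝓞 K)⁰ K)), z = Ω * w₀.embedding y) ∧ ((Ideal.absNorm 𝔠 : ℂ_[2]) -
          ((ι.symm (idealPow K χ 𝔠 * idealPow K (fun w ↦ lam.valueAtUniformizer w) 𝔠 ^ m) : PadicAlgCl 2) : ℂ_[2])) * I' = ((ι.symm ((1 - (εH.valueAtUniformizer v)⁻¹ * (((2 : ℕ) : ℂ))⁻¹) * ∑ 𝔟 ∈ T, (idealPow K χ 𝔟)⁻¹ * (idealPow K (fun w ↦ lam.valueAtUniformizer w) 𝔟 ^ m)⁻¹ *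
              ((Ideal.absNorm 𝔠 : ℂ) * (L 𝔟).eisensteinE m Ω - (L (𝔠 * 𝔟)).eisensteinE m Ω)) : PadicAlgCl 2) : ℂ_[2]) * ((Ωp : unrIntegers 2) : ℂ_[2]) ^ m := by
  obtain ⟨T, hT, hL1, hL2, hid⟩ := classSum_at_level_of_perUnitValues h24ii h24iii h25 hK ι w₀ hv2 hvbar2 hne hι hv0 hq h2 u hu
    hσ₀ hε θ hθc hθ1 hθζ e₂ hΘe hvS hvbarS 𝔣 𝔩 h𝔣succ hdiv hcof h𝔣0 h𝔣1 hvm hwm hle α hα0 hα𝔣 hαw f hαπ E hE hdegE hEE j hj hjC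
    hjj ψ hψ g hg x hx μ hμ k M hkM lam hl hlmod h𝔪1 hw χ hχ 𝔠 h𝔠0 h𝔠cop h𝔠v εH eH m he hm hεt hεunr hεu hL A₁ Ω hΩ hβ₁
    Ω₁ hΩ₁ Ω₁' hΩ₁' LM hLM Lat hLat hvals
  refine ⟨T, Lat, hT, hL1, hL2, ?_⟩
  -- cancel the `12` and substitute the scalars
  set Θε : ℂ_[2] := (θ.comp ((CBall (v.adicCompletion K)).subtype.comp
    (algebraMap (UnrCoeff (v.adicCompletion K)) (CBall (v.adicCompletion K)))))
      (PowerSeries.coeff 1 (compSeriesC h2 hσ₀ u hε)) with hΘε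
  have h12 : (12 : ℂ_[2]) ≠ 0 := by norm_num
  refine mul_left_cancel₀ h12 ?_
  rw [hΩp]
  calc (12 : ℂ_[2]) * ((((Ideal.absNorm 𝔠 : ℂ_[2]) -
          ((ι.symm (idealPow K χ 𝔠 * idealPow K (fun w ↦ lam.valueAtUniformizer w) 𝔠 ^ m) : PadicAlgCl 2) : ℂ_[2]))) * I')
      = ((Ideal.absNorm 𝔠 : ℂ_[2]) -
          ((ι.symm (idealPow K χ 𝔠 * idealPow K (fun w ↦ lam.valueAtUniformizer w) 𝔠 ^ m) : PadicAlgCl 2) : ℂ_[2])) *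
          ((12 : ℂ_[2]) * I') := by ring
    _ = D * (((Ideal.absNorm 𝔠 : ℂ_[2]) -
          ((ι.symm (idealPow K χ 𝔠 * idealPow K (fun w ↦ lam.valueAtUniformizer w) 𝔠 ^ m) : PadicAlgCl 2) : ℂ_[2])) *
          (Θε * μ.integral (fun σ ↦ avatarValueAt eH σ))) := by rw [hI]; ring
    _ = _ := by rw [hid]; ring

end Summit.BirchSwinnertonDyer.BirchSwinnertonDyer.Theorems.PrintCf2.KatzMeasureJZeroSeam

end
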